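import Summits.QuantumFields.YangMills.Theorems.VirialFluxGapFixGenericParametersEta
import Summits.QuantumFields.YangMills.Theorems.VirialFluxGapFixGenericPointwiseSix
import HarnessLib

/-!
# Route `VirialFluxGap` ∕ the (P) road to ⟨24196⟩: the SIX-KERNEL-VECTOR (E2) on the generic region at divergence target `η` —
# `½(#ι − 6) + η/8` under the `η²`-deficit window (δ-rerun S1b of ✓`VirialFluxGapFixGenericParameters` §§2–3; LEAD g97 allocation ➊)

LEAD g97's ✓`fix_generic_divergence_upper_six` (E1, ✓`…FixGenericPointwiseSix`: six orthonormal kernel vectors at every comb base point, central or not)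
carries the free parameters `λ⋆` and the `u`-free error terms of ✓`fix_generic_divergence_upper`, with `(#ι − 4, 4·s′/(s′+λ⋆))` replaced by
`(#ι − 6, 6·s′/(s′+λ⋆))`.  With the parameter arithmetic of ✓`…FixGenericParametersEta` (S1a: `λ⋆ = εκ/3`, window `D ≤ η²·ε³κ²/(10⁴(K+1)²#ι⁵)`,
✓`param_divergence_error_six`):
* ★★★ `fix_generic_divergence_upper_eps_six` — `½tr(A⁻¹H) − ½Σ_i(A⁻¹B_iA⁻¹g)_i ≤ ½(#ι − 6) + η/8` at every slice-0 comb-gauged `ρ`-regular point with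
  `224L²√F₀ < ρ` in the `η²`-window;
* ★★★ `fix_generic_divergence_upper_window_six` — the same from the ONE threshold `F₀(P) ≤ η²·t₀`, `t₀ = ρ²ε³κ²/(1032960·10⁴·L⁸(K+1)²#ι⁵)`.
In the normalisation `X = 2X_g` of «EulerFieldFix» this is divergence `≤ #ι − 6 + η/4 = 18L⁴ − 3 + η/4` on the generic region (✓`card_fixVar_mul_three`);
(E1) drive and the floor are unchanged (the `η²`-window implies the old one, ✓`param_window_mono`).  Parts S2–S6 rerun the assembly.

HONEST LABEL: pointwise, generic region only; no field is assembled here; nothing about ⟨24196⟩ ∕ ⟨24194⟩ ∕ ⟨24197⟩ (OPEN) is proved; item of record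
⟨24085⟩ SubOctaveBounded aside ∕ untouched; the Yang–Mills mass gap is NOT proved; no summit is proved by a line.  THEOREMS ONLY (0 `def`, 0 `sorry`), standard
axioms.  Seat ym-line-fcl-p3 g47 (cell ym-idea-1, free hands), `--supports stmt-QuantumFields-24196`.  References: [cite: Luscher1983, §2]; [folklore].
-/

set_option autoImplicit false

noncomputable section

open scoped Matrix BigOperators ContDiff Topology Quaternion
open MeasureTheory Set Matrix
open Literature.MathematicalPhysics.QuantumFieldTheory hiding SU2
open Literature.MathematicalPhysics.QuantumLattice
open Literature.MathematicalPhysics.QuantumFieldTheory.SUNBakryEmery (expSU coe_expSU matTop)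

namespace Summit.QuantumFields.YangMills.Theorems.VirialFluxGap.FrameHessian

open Summit.QuantumFields.YangMills.Theorems.FemtoTransferGap
open Summit.QuantumFields.YangMills.Theorems.FemtoTransferGap.TT
open Summit.QuantumFields.YangMills.Theorems.FemtoTransferGap.TwoLattice
open Summit.QuantumFields.YangMills.Theorems.FemtoTransferGap.TwoLattice.Flat
open Summit.QuantumFields.YangMills.Theorems.VirialFluxGap.RingDeficit
open Summit.QuantumFields.YangMills.Theorems.VirialFluxGap.FrameDerivative
open Summit.QuantumFields.YangMills.Theorems.VirialFluxGap.ResolventField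
open Summit.QuantumFields.YangMills.Theorems.VirialFluxGap.RegularValley
open Summit.QuantumFields.YangMills.Theorems.VirialFluxGap.FixFrame

variable {L : ℕ} [NeZero L]

open scoped Matrix.Norms.Frobenius

/-- ★★★ **(E2) with SIX kernel vectors, ε-form at target `η`.**  At a slice-0 comb-gauged `ρ`-regular point with `224L²√F₀(P) < ρ` and the
`η²`-deficit window `1032960L⁸F₀(P)/ρ² ≤ η²·ε³κ²/(10⁴(K+1)²#ι⁵)` (`κ = ρ²/(1032960L⁸)`), with `λ⋆ = εκ/3`, `B_i = ∂_{τ_i}H`: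
`½tr(A⁻¹H) − ½Σ_i(A⁻¹B_iA⁻¹g)_i ≤ ½(#ι − 6) + η/8`. [cite: Luscher1983, §2] -/
theorem fix_generic_divergence_upper_eps_six [DecidableEq (FixVar L × Fin 3)] (P : ((Fin (2 * L - 1 + 1) → GaugeConfig 3 L SU2) × (Site 3 L → SU2)))
    (hP : ∀ e : Edge 3 L, treeEdge e = true → P.1 0 e = 1) {ρ : ℝ} (hρ : 0 < ρ)
    (hfar : (∃ k : Fin 3, ρ ^ 2 ≤ 1 - (su2Quat (wrapReps (P.1 0) k)).re ^ 2) ∨ ρ ^ 2 ≤ 1 - (su2Quat (P.2 0)).re ^ 2)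
    (hsmall : 224 * (L : ℝ) ^ 2 * Real.sqrt (ringDeficit L (fun _ => false) P) < ρ)
    {K ε η : ℝ} (hK : 0 ≤ K) (hε : 0 < ε) (hε1 : ε ≤ 1) (hη : 0 < η) (hη1 : η ≤ 1)
    (hK3 : ∀ (Y₁ Y₂ Y₃ : ((Fin (2 * L - 1 + 1) × Edge 3 L) ⊕ Site 3 L) → Matrix (Fin 2) (Fin 2) ℂ) (b₁ b₂ b₃ : ℝ), 0 ≤ b₁ → 0 ≤ b₂ → 0 ≤ b₃ →
      (∀ w, ‖Y₁ w‖ ≤ b₁) → (∀ w, ‖Y₂ w‖ ≤ b₂) → (∀ w, ‖Y₃ w‖ ≤ b₃) → ∀ Q : ((Fin (2 * L - 1 + 1) → GaugeConfig 3 L SU2) × (Site 3 L → SU2)),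
      |frameD Y₁ (frameD Y₂ (frameD Y₃ (ringPoly L))) (ringCoord L Q)| ≤ K * b₁ * b₂ * b₃)
    (hD : 1032960 * (L : ℝ) ^ 8 * ringDeficit L (fun _ => false) P / ρ ^ 2 ≤
      η ^ 2 * (ε ^ 3 * (ρ ^ 2 / (1032960 * (L : ℝ) ^ 8)) ^ 2 / (10000 * (K + 1) ^ 2 * (Fintype.card (FixVar L × Fin 3) : ℝ) ^ 5))) :
    (1 / 2) * Matrix.trace ((frameHess (L := L) fixFrameStd (ringCoord L P) + (ε * (ρ ^ 2 / (1032960 * (L : ℝ) ^ 8)) / 3) •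
            (1 : Matrix (FixVar L × Fin 3) (FixVar L × Fin 3) ℝ))⁻¹ * frameHess (L := L) fixFrameStd (ringCoord L P)) -
        (1 / 2) * ∑ i, ((frameHess (L := L) fixFrameStd (ringCoord L P) + (ε * (ρ ^ 2 / (1032960 * (L : ℝ) ^ 8)) / 3) •
            (1 : Matrix (FixVar L × Fin 3) (FixVar L × Fin 3) ℝ))⁻¹ *ᵥ
          ((fun j' k => frameD (fixFrameStd i) (fun M => frameHess (L := L) fixFrameStd M j' k) (ringCoord L P)) *ᵥ
            ((frameHess (L := L) fixFrameStd (ringCoord L P) + (ε * (ρ ^ 2 / (1032960 * (L : ℝ) ^ 8)) / 3) •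
                (1 : Matrix (FixVar L × Fin 3) (FixVar L × Fin 3) ℝ))⁻¹ *ᵥ
              frameGrad (L := L) fixFrameStd (ringCoord L P)))) i ≤
      (1 / 2) * ((Fintype.card (FixVar L × Fin 3) : ℝ) - 6) + η / 8 := by
  set κ := ρ ^ 2 / (1032960 * (L : ℝ) ^ 8) with hκ
  set c : ℝ := (Fintype.card (FixVar L × Fin 3) : ℝ) with hc
  set D := 1032960 * (L : ℝ) ^ 8 * ringDeficit L (fun _ => false) P / ρ ^ 2 with hDdef
  have hL0 : (0 : ℝ) < L := by exact_mod_cast NeZero.pos L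
  have hκ0 : 0 < κ := by rw [hκ]; positivity
  have hc21 : 21 ≤ c := card_fixVar_mul_three_ge
  have hF0 : 0 ≤ ringDeficit L (fun _ => false) P := ringDeficit_nonneg _ _
  have hD0 : 0 ≤ D := by rw [hDdef]; positivity
  have hDold : D ≤ ε ^ 3 * κ ^ 2 / (10000 * (K + 1) ^ 2 * c ^ 5) := param_window_mono hε hκ0 hc21 hη hη1 hD
  have hsm2 : K * Real.sqrt (c * D) * c ≤ (ε * κ / 3) / 2 := param_smallness hε hε1 hK hκ0 hc21 hD0 hDold
  have hsm2' : K * Real.sqrt (Fintype.card (FixVar L × Fin 3) * (1032960 * (L : ℝ) ^ 8 * ringDeficit L (fun _ => false) P / ρ ^ 2)) *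
      Fintype.card (FixVar L × Fin 3) ≤ (ε * κ / 3) / 2 := hsm2
  have key := fix_generic_divergence_upper_six P hP hρ hfar hsmall hK (by positivity : 0 < ε * κ / 3) hK3 hsm2'
  have herr := param_divergence_error_six hε hε1 hK hκ0 hc21 hD0 hη hη1 hD
  linarith

/-- ★★★ **(E2) with SIX kernel vectors under the `η²`-deficit window.**  With `t₀ = ρ²ε³κ²/(1032960·10⁴·L⁸(K+1)²#ι⁵)`: at every slice-0 comb-gauged
`ρ`-regular point with `F₀(P) ≤ η²·t₀`, `½tr(A⁻¹H) − ½Σ_i(A⁻¹B_iA⁻¹g)_i ≤ ½(#ι − 6) + η/8` with `λ⋆ = εκ/3`. [cite: Luscher1983, §2] -/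
theorem fix_generic_divergence_upper_window_six [DecidableEq (FixVar L × Fin 3)] (P : ((Fin (2 * L - 1 + 1) → GaugeConfig 3 L SU2) × (Site 3 L → SU2)))
    (hP : ∀ e : Edge 3 L, treeEdge e = true → P.1 0 e = 1) {ρ : ℝ} (hρ : 0 < ρ) (hρ1 : ρ ≤ 1)
    (hfar : (∃ k : Fin 3, ρ ^ 2 ≤ 1 - (su2Quat (wrapReps (P.1 0) k)).re ^ 2) ∨ ρ ^ 2 ≤ 1 - (su2Quat (P.2 0)).re ^ 2)
    {K ε η : ℝ} (hK : 0 ≤ K) (hε : 0 < ε) (hε1 : ε ≤ 1) (hη : 0 < η) (hη1 : η ≤ 1)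
    (hK3 : ∀ (Y₁ Y₂ Y₃ : ((Fin (2 * L - 1 + 1) × Edge 3 L) ⊕ Site 3 L) → Matrix (Fin 2) (Fin 2) ℂ) (b₁ b₂ b₃ : ℝ), 0 ≤ b₁ → 0 ≤ b₂ → 0 ≤ b₃ →
      (∀ w, ‖Y₁ w‖ ≤ b₁) → (∀ w, ‖Y₂ w‖ ≤ b₂) → (∀ w, ‖Y₃ w‖ ≤ b₃) → ∀ Q : ((Fin (2 * L - 1 + 1) → GaugeConfig 3 L SU2) × (Site 3 L → SU2)),
      |frameD Y₁ (frameD Y₂ (frameD Y₃ (ringPoly L))) (ringCoord L Q)| ≤ K * b₁ * b₂ * b₃)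
    (ht : ringDeficit L (fun _ => false) P ≤ η ^ 2 * (ρ ^ 2 * ε ^ 3 * (ρ ^ 2 / (1032960 * (L : ℝ) ^ 8)) ^ 2 /
      (1032960 * 10000 * (L : ℝ) ^ 8 * (K + 1) ^ 2 * (Fintype.card (FixVar L × Fin 3) : ℝ) ^ 5))) :
    (1 / 2) * Matrix.trace ((frameHess (L := L) fixFrameStd (ringCoord L P) + (ε * (ρ ^ 2 / (1032960 * (L : ℝ) ^ 8)) / 3) •
            (1 : Matrix (FixVar L × Fin 3) (FixVar L × Fin 3) ℝ))⁻¹ * frameHess (L := L) fixFrameStd (ringCoord L P)) -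
        (1 / 2) * ∑ i, ((frameHess (L := L) fixFrameStd (ringCoord L P) + (ε * (ρ ^ 2 / (1032960 * (L : ℝ) ^ 8)) / 3) •
            (1 : Matrix (FixVar L × Fin 3) (FixVar L × Fin 3) ℝ))⁻¹ *ᵥ
          ((fun j' k => frameD (fixFrameStd i) (fun M => frameHess (L := L) fixFrameStd M j' k) (ringCoord L P)) *ᵥ
            ((frameHess (L := L) fixFrameStd (ringCoord L P) + (ε * (ρ ^ 2 / (1032960 * (L : ℝ) ^ 8)) / 3) •
                (1 : Matrix (FixVar L × Fin 3) (FixVar L × Fin 3) ℝ))⁻¹ *ᵥ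
              frameGrad (L := L) fixFrameStd (ringCoord L P)))) i ≤
      (1 / 2) * ((Fintype.card (FixVar L × Fin 3) : ℝ) - 6) + η / 8 := by
  have hL1 : (1 : ℝ) ≤ L := by exact_mod_cast NeZero.one_le
  obtain ⟨hsmall, -, hD⟩ := param_window_eta hρ hρ1 hε hε1 hK card_fixVar_mul_three_ge hL1 hη hη1 ht
  exact fix_generic_divergence_upper_eps_six P hP hρ hfar hsmall hK hε hε1 hη hη1 hK3 hD

end Summit.QuantumFields.YangMills.Theorems.VirialFluxGap.FrameHessian

end
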